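import Summits.CriticalPhenomena.PercolationContinuityZ3.Theorems.Transplant.SkelPhiFaceExitPieces
import Summits.CriticalPhenomena.PercolationContinuityZ3.Theorems.Transplant.SkelPhiVLineExitGoals
import HarnessLib

/-!
# N1 ({±1} node), (F) column, part K3 (hp-8 g33): **THE ORIENTATION-AWARE EXIT TABLE OF A FACE-FRAME LEVEL KIT** — every side of the frame box
# `(frame I b)` is a LINE FORM of `φ`: the level side `I = 0` has form `vβ·α − vα·β`, the level side `I = 1` has form `n·β − h·α = β′_L`, the raw side
# has form `α` (`b = 0`) or `β` (`b = 1`); p1-g12's one-piece v-line table `pexVL G φ Q C a b e c` (p298155: side half or top piece of the kit pair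
# in its own orientation, `pexVL_goal : C·(|a|+|b|) ≤ e·(a·Δα + b·Δβ)` under the kit pair's EqGeom and `4C+1 ≤ M`, `2C ≤ n_kit`) therefore serves
# ALL FOUR SIDES: `pexFO I b Q C i σ₀ c := pexVL G φ Q C (coefA I b i) (coefB I b i) σ₀ c`.  The exit inequality `L(φ v) + A' + climC ≤ L(φ c)`
# (the `hPex` input of `hkits_face_of_routeG`, p299284) follows from the generic closers `exit_frame_raw_of_disp` / `exit_frame_lv_of_form` below
# and two integer rooms: `A' + 2D ≤ C·D` (raw) and `A' + climC I b I + D ≤ k·D`, `(k+1)·D ≤ C·(cOf I·L I)` (level).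
builds on p205010 (kernel theorem, internal audit signed; external expert review pending) — nothing in this file uses p205010; no claim about the open node.
Lane `prim-bschramm`, seat `prim-hp-8` (gen 33); helper file (`--supports stmt-CriticalPhenomena-4575 --as helper`).
* §1 `FinePrm.exit_frame_raw_of_disp`, `exit_frame_lv_of_form`; §2 defs `FinePrm.coefA/coefB`, **`pexFO`**, `pexFO_subset`; §3 **`hPex_pexFO`**.
[cite: MartineauTassion2017, §3.2 Lemma 3.5, §4.3 Lemma 4.2] [cite: KozmaNitzan2024, §4 Lemma 10 (pp. 17–21)]
-/

noncomputable section

open scoped Classical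

namespace Summit.CriticalPhenomena.PercolationContinuityZ3.Theorems.Transplant

namespace Skelφ

open Literature.Probability.Percolation Literature.Probability.LatticeModels SimpleGraph KNCells KNLevels GadgetSystem Contour
open Literature.Probability.Percolation.KozmaNitzan.Cells (oth oth_ne eq_oth_of_ne oth_oth)
open Literature.Barriers.CriticalPhenomena (graphBall graphBall_finite mem_graphBall_self graphBall_mono)
open TwoAxis.Para (coarse lam0 lam1 bp modulus detD)

variable {V : Type} {G : SimpleGraph V} [G.LocallyFinite]

namespace FinePrm

variable (pr : FinePrm) (φ : V → Site 2) (t : V)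

/-! ## §1 Generic closers: raw side from a displacement, level side from the line form -/

/-- **RAW-SIDE EXIT FROM A DISPLACEMENT**: `k ≤ σ₀·(φ v b − φ c b)` and `A' + 2D ≤ k·D` give `L(φ v) + A' + climC ≤ L(φ c)` on the raw side
`(oth I, σ₀)`. [cite: MartineauTassion2017, §3.2] -/
theorem exit_frame_raw_of_disp (I b : Fin 2) (hc : 0 < pr.cOf I) (hA : pr.A ≠ 0) (hnz : pr.lvGen I b ≠ 0) (hD : 0 < pr.D)
    (hL : pr.cOf I * pr.L I ≤ pr.D) (Lo Hi : Site 2) (σ₀ : ℤˣ) {A' k : ℤ} (hexit : A' + 2 * pr.D ≤ k * pr.D) {c v : V}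
    (hdisp : k ≤ (σ₀ : ℤ) * (φ v b - φ c b)) :
    (pr.sideFormsU_frame φ t I b hc hA hnz hD Lo Hi (oth I) σ₀).lin (φ v) + A' + pr.climC I b (oth I) ≤
      (pr.sideFormsU_frame φ t I b hc hA hnz hD Lo Hi (oth I) σ₀).lin (φ c) := by
  have hC : pr.climC I b (oth I) = pr.D := by unfold climC; rw [if_neg (oth_ne I)]
  refine SideForm.exit_of_depth_gap _ (pr.sideFormsU_frame_isAffine φ t I b hc hA hnz hD hL Lo Hi (oth I) σ₀) hD.le (k := k)
    (by rw [hC]; linarith) (depth_gap_of_disp ?_)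
  rw [pr.frame_sub_raw, relCoord_apply]
  exact hdisp

/-- The level form of axis `I` as a line form `a·α + b·β` of `φ`: `(a, b) = (vβ, −vα)` for `I = 0`, `(−h, n)` for `I = 1`. [this work] -/
def lvA (I : Fin 2) : ℤ := if I = 0 then pr.vβ else -pr.h

/-- Second coefficient of the level line form. [this work] -/
def lvB (I : Fin 2) : ℤ := if I = 0 then -pr.vα else pr.n

/-- `|lvA I| + |lvB I|` is `L I / |A|`: `|A|·(|lvA I| + |lvB I|) = L I`. [folklore] -/
theorem abs_A_mul_lv (I : Fin 2) : |pr.A| * (|pr.lvA I| + |pr.lvB I|) = pr.L I := by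
  unfold lvA lvB
  obtain rfl | rfl : I = 0 ∨ I = 1 := by fin_cases I <;> simp
  · simp only [if_true, abs_neg]
    rw [pr.L_zero, add_comm]
  · simp only [show (1 : Fin 2) ≠ 0 from by decide, if_false, abs_neg]
    rw [pr.L_one, add_comm]

/-- **LEVEL-SIDE EXIT FROM THE LINE FORM**: `C·(|lvA I| + |lvB I|) ≤ σ₀·(lvA I·Δα + lvB I·Δβ)` with `A' + climC I b I + D ≤ k·D` and
`(k+1)·D ≤ C·(cOf I·L I)` give `L(φ v) + A' + climC ≤ L(φ c)` on the level side `(I, σ₀)` (`0 < A`). [cite: MartineauTassion2017, §3.2] -/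
theorem exit_frame_lv_of_form (I b : Fin 2) (hc : 0 < pr.cOf I) (hA : pr.A ≠ 0) (hnz : pr.lvGen I b ≠ 0) (hD : 0 < pr.D)
    (hL : pr.cOf I * pr.L I ≤ pr.D) (Lo Hi : Site 2) (σ₀ : ℤˣ) (hA0 : 0 < pr.A) {A' k C : ℤ}
    (hexit : A' + pr.climC I b I + pr.D ≤ k * pr.D) (hk : (k + 1) * pr.D ≤ C * (pr.cOf I * pr.L I)) {c v : V}
    (hform : C * (|pr.lvA I| + |pr.lvB I|) ≤ (σ₀ : ℤ) * (pr.lvA I * (φ v 0 - φ c 0) + pr.lvB I * (φ v 1 - φ c 1))) :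
    (pr.sideFormsU_frame φ t I b hc hA hnz hD Lo Hi I σ₀).lin (φ v) + A' + pr.climC I b I ≤
      (pr.sideFormsU_frame φ t I b hc hA hnz hD Lo Hi I σ₀).lin (φ c) := by
  have hσ : (σ₀ : ℤ) = 1 ∨ (σ₀ : ℤ) = -1 := by rcases Int.units_eq_one_or σ₀ with h | h <;> simp [h]
  have habsA : |pr.A| = pr.A := abs_of_pos hA0
  refine SideForm.exit_of_depth_gap _ (pr.sideFormsU_frame_isAffine φ t I b hc hA hnz hD hL Lo Hi I σ₀) hD.le (k := k) hexit
    (depth_gap_of_disp ?_)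
  -- the form inequality scaled by `cOf I · A`
  have hscaled : (k + 1) * pr.D ≤ (σ₀ : ℤ) * (pr.cOf I * (pr.A * (pr.lvA I * (φ v 0 - φ c 0) + pr.lvB I * (φ v 1 - φ c 1)))) := by
    have h1 : C * (pr.cOf I * pr.L I) = pr.cOf I * pr.A * (C * (|pr.lvA I| + |pr.lvB I|)) := by
      rw [← pr.abs_A_mul_lv I, habsA]; ring
    have h2 := mul_le_mul_of_nonneg_left hform (mul_pos hc hA0).le
    calc (k + 1) * pr.D ≤ C * (pr.cOf I * pr.L I) := hk
      _ = _ := h1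
      _ ≤ _ := h2
      _ = _ := by ring
  obtain rfl | rfl : I = 0 ∨ I = 1 := by fin_cases I <;> simp
  · rw [pr.frame_apply_lv_zero, pr.frame_apply_lv_zero]
    have hc₀ : pr.cOf 0 = pr.c₀ := pr.cOf_zero
    set lv := lam0 pr.A pr.vα pr.vβ (relφ φ t v) with hlv
    set lc := lam0 pr.A pr.vα pr.vβ (relφ φ t c) with hlc
    have hM : (k + 1) * pr.D ≤ (σ₀ : ℤ) * (pr.c₀ * (lv - lc)) := by
      rw [hlv, hlc, lam0_relφ_sub, ← hc₀]
      have e : pr.A * (pr.vβ * (φ v 0 - φ c 0) - pr.vα * (φ v 1 - φ c 1)) = pr.A * (pr.lvA 0 * (φ v 0 - φ c 0) + pr.lvB 0 * (φ v 1 - φ c 1)) := by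
        unfold lvA lvB; simp only [if_true]; ring
      rw [e]; exact hscaled
    have hms := mul_sub pr.c₀ lv lc
    rcases hσ with h1 | h1
    · rw [h1, one_mul] at hM
      rw [h1, one_mul]
      exact le_coarse_sub_of_mul hD (by linarith)
    · rw [h1, neg_one_mul] at hM
      rw [h1, neg_one_mul, neg_sub]
      exact le_coarse_sub_of_mul hD (by linarith)
  · rw [pr.frame_apply_lv_one, pr.frame_apply_lv_one]
    have hc₁ : pr.cOf 1 = pr.c₁ := pr.cOf_one
    set lv := lam1 pr.A pr.n pr.h (relφ φ t v) with hlv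
    set lc := lam1 pr.A pr.n pr.h (relφ φ t c) with hlc
    have hM : (k + 1) * pr.D ≤ (σ₀ : ℤ) * (pr.c₁ * (lv - lc)) := by
      rw [hlv, hlc, lam1_relφ_sub, ← hc₁]
      have e : pr.A * (pr.n * (φ v 1 - φ c 1) - pr.h * (φ v 0 - φ c 0)) = pr.A * (pr.lvA 1 * (φ v 0 - φ c 0) + pr.lvB 1 * (φ v 1 - φ c 1)) := by
        unfold lvA lvB; simp only [show (1 : Fin 2) ≠ 0 from by decide, if_false]; ring
      rw [e]; exact hscaled
    have hms := mul_sub pr.c₁ lv lc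
    rcases hσ with h1 | h1
    · rw [h1, one_mul] at hM
      rw [h1, one_mul]
      exact le_coarse_sub_of_mul hD (by linarith)
    · rw [h1, neg_one_mul] at hM
      rw [h1, neg_one_mul, neg_sub]
      exact le_coarse_sub_of_mul hD (by linarith)

/-! ## §2 The table -/

/-- Line-form coefficient `a` of side `i` of the frame `(I, b)`: level side → `lvA I`, raw side → `[b = 0]`. [this work] -/
def coefA (I b i : Fin 2) : ℤ := if i = I then pr.lvA I else if b = 0 then 1 else 0

/-- Line-form coefficient `b` of side `i`: level side → `lvB I`, raw side → `[b = 1]`. [this work] -/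
def coefB (I b i : Fin 2) : ℤ := if i = I then pr.lvB I else if b = 0 then 0 else 1

variable (G)

/-- **THE FACE EXIT TABLE** `pexFO I b Q C i σ₀ c := pexVL G φ Q C (coefA I b i) (coefB I b i) σ₀ c` (p1-g12's one-piece v-line table on the
side's line form). [cite: MartineauTassion2017, §3.2 Lemma 3.5] -/
def pexFO [DecidableEq V] (I b : Fin 2) (Q : ShortPcO V) (C : ℕ) (i : Fin 2) (σ₀ : ℤˣ) (c : V) : Finset V :=
  pexVL G φ Q C (pr.coefA I b i) (pr.coefB I b i) (σ₀ : ℤ) c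

variable {G}

/-- Every entry of the table lies in the short prism `RgO`. [folklore] -/
theorem pexFO_subset [DecidableEq V] (I b : Fin 2) (Q : ShortPcO V) (C : ℕ) (i : Fin 2) (σ₀ : ℤˣ) (c : V) : pr.pexFO G φ I b Q C i σ₀ c ⊆ RgO G φ Q c :=
  pexVL_subset Q C _ _ _ c

/-! ## §3 The exit inequalities of the table -/

/-- **THE EXIT INEQUALITIES OF THE FACE TABLE** (the `hPex` input of `hkits_face_of_routeG`): under the kit pair's EqGeom and `4C+1 ≤ M`, `2C ≤ n_kit`
at every centre, the raw room `A' + 2D ≤ C·D` and the level rooms `A' + climC I b I + D ≤ k·D`, `(k+1)·D ≤ C·(cOf I·L I)`.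
[cite: MartineauTassion2017, §3.2 Lemma 3.5, §4.3 Lemma 4.2] -/
theorem hPex_pexFO [DecidableEq V] (I b : Fin 2) (hc : 0 < pr.cOf I) (hA : pr.A ≠ 0) (hnz : pr.lvGen I b ≠ 0) (hD : 0 < pr.D) (hL : pr.cOf I * pr.L I ≤ pr.D)
    (hA0 : 0 < pr.A) (Q : ShortPcO V) {C M : ℕ} (hn1 : ∀ c, 1 ≤ Q.nS c)
    (hEq : ∀ c, ((M : ℤ) + 1) * (Q.nS c + |Q.hS c|) ≤ (Q.nS c : ℤ) * (Q.ℓS c + 1)) (hM : 4 * C + 1 ≤ M) (hn : ∀ c, 2 * C ≤ Q.nS c)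
    {A' k : ℤ} (hexitR : A' + 2 * pr.D ≤ (C : ℤ) * pr.D) (hexitL : A' + pr.climC I b I + pr.D ≤ k * pr.D)
    (hk : (k + 1) * pr.D ≤ (C : ℤ) * (pr.cOf I * pr.L I)) (Lo Hi : Site 2) (i : Fin 2) (σ₀ : ℤˣ) (c : V) :
    ∀ v ∈ pr.pexFO G φ I b Q C i σ₀ c,
      (pr.sideFormsU_frame φ t I b hc hA hnz hD Lo Hi i σ₀).lin (φ v) + A' + pr.climC I b i ≤
        (pr.sideFormsU_frame φ t I b hc hA hnz hD Lo Hi i σ₀).lin (φ c) := by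
  intro v hv
  have hσ : (σ₀ : ℤ) = 1 ∨ (σ₀ : ℤ) = -1 := by rcases Int.units_eq_one_or σ₀ with h | h <;> simp [h]
  have hgoal := pexVL_goal (G := G) (φ := φ) hσ (hn1 c) (hEq c) hM (hn c) hv
  rw [relCoord_apply, relCoord_apply] at hgoal
  by_cases hi : i = I
  · subst hi
    have ha : pr.coefA i b i = pr.lvA i := by unfold coefA; rw [if_pos rfl]
    have hb : pr.coefB i b i = pr.lvB i := by unfold coefB; rw [if_pos rfl]
    rw [ha, hb] at hgoal
    exact pr.exit_frame_lv_of_form φ t i b hc hA hnz hD hL Lo Hi σ₀ hA0 hexitL hk hgoal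
  · rw [eq_oth_of_ne hi]
    have hdisp : (C : ℤ) ≤ (σ₀ : ℤ) * (φ v b - φ c b) := by
      obtain rfl | rfl : b = 0 ∨ b = 1 := by fin_cases b <;> simp
      · have ha : pr.coefA I 0 i = 1 := by unfold coefA; rw [if_neg hi, if_pos rfl]
        have hb : pr.coefB I 0 i = 0 := by unfold coefB; rw [if_neg hi, if_pos rfl]
        rw [ha, hb] at hgoal
        simpa using hgoal
      · have ha : pr.coefA I 1 i = 0 := by unfold coefA; rw [if_neg hi, if_neg (by decide)]
        have hb : pr.coefB I 1 i = 1 := by unfold coefB; rw [if_neg hi, if_neg (by decide)]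
        rw [ha, hb] at hgoal
        simpa using hgoal
    exact pr.exit_frame_raw_of_disp φ t I b hc hA hnz hD hL Lo Hi σ₀ hexitR hdisp

end FinePrm

end Skelφ

end Summit.CriticalPhenomena.PercolationContinuityZ3.Theorems.Transplant

end
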